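/-
Copyright (c) 2026 the pub-hodgecm-mathlib formalisation cell (harness21).  Prover seat hodgecm-mathlib-A-p16 (g33): road «S3-ram» (LEAD F0P3a-plan (g13); owner lineage
F0P3a-p06), the (Cnt2′) BLOCK-LAW skeleton (keeper F0P3a-p06 (g16), chair F0P3a-p07 (g15) RULING (13)(6)): composition pen `stub_Zaniso` — THE ANISOTROPIC LITERAL'S
ROW-`0` TOTAL IN THE SOCKET'S OWN CURRENCY, from the ★ route-B singleton heads; 2026-09-02.
-/
import Literature.NumberTheory.Rogawski1990.DepthZeroKappaTransferTypeOneRamifiedJunctionStrataCountAnisotropic   -- ★ p849055 + ED. 2 ★ p849100 (F0P3a-p08 (g20)): `…_{raw,even}_singleton_of_anisotropic_frame_of_entry`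
import Literature.NumberTheory.Automorphic.UnitaryLatticeTreeBlockLiteralCentring                                  -- ★ p849074 (F0P3-p01 (g19)): centring `P·ι(γ₁,u)·P⁻¹ ↦ P·ι(sγ₁,1)·P⁻¹`, strata-set invariance
import Literature.NumberTheory.Automorphic.UnitaryLatticeTreeAnisotropicBlockConformal                              -- ★ p849115 (F0P3a-p08 (g20)): conformality `‖γ₁ − u·1‖² = |det|`
import Literature.NumberTheory.Rogawski1990.DepthZeroKappaTransferTypeTwoRamifiedIntrinsicOfBlockLawZero           -- ★ p848712 (F0P3a-p03 (g18)): the CM dress of the block law (socket tokens `finCharpolyTwo`, `finGammaTwo`, `cmDatum`, `localNonsplitEquiv`, …)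
import Literature.NumberTheory.Rogawski1990.UnitaryVertexStabilizerSpanSelfDualTameRamifiedCM                       -- ★ `ramifiedBlock_adicCompletion` (`hres`, `hnorm` at a tame-ramified CM place)
import Literature.NumberTheory.Rogawski1990.UnitaryVertexStabilizerCoverCM                                         -- ★ `isPrincipalIdealRing_integer_adicCompletion`
import Literature.NumberTheory.Automorphic.UnitaryGroupIntegralPointsReductionRamified                               -- ★ `natCard_residueField_eq_of_ramified`
import Literature.NumberTheory.Automorphic.ValuedFieldValuativeRelBridge                                             -- ★ `natCard_residueField_eq_of_compatible`
import Literature.NumberTheory.Rogawski1990.UnitFundamentalLemmaInertFlickerFrame                                    -- ★ `isUnit_two_integer_iff_valued_eq_one`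
import Literature.NumberTheory.Automorphic.UnitaryGroupInertPlaceHyperbolicBasis                                     -- ★ `galAdicCompletionMap_galAdicCompletionMap_of_smul_eq`
import Literature.NumberTheory.Automorphic.HyperspecialUnitaryCartanAdicCompletion                                   -- ★ `exists_sq_eq_of_valued_sub_one_lt` (principal units are squares)
import Literature.NumberTheory.Automorphic.LocalUnitaryIntegralLevel                                                 -- ★ `placeForm_antidiagOne`
import Literature.NumberTheory.Automorphic.UnitaryLatticeTreeBlockTubeBoundFixedFinite                              -- ★ `eval_charpoly_fin_two_eq_det_sub_smul_one`
import Literature.NumberTheory.Automorphic.ProjectiveDescentLatticeLevelsDischarge                                   -- ★ `valued_toPlace_eq_pow_two_of_ramified`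
import Literature.NumberTheory.Rogawski1990.ExplicitFactorKappaAlmostEverywhereOne                                   -- ★ `conjLocal_finGammaTwo_mul_finGammaTwo` (`σ(u)·u = 1`)
import HarnessLib

/-!
# The ramified `κ`-orbital integral, type (2): THE ROW-`0` TOTAL OF THE ANISOTROPIC LITERAL `P₁·ι(γ₁, u_w)·P₁⁻¹` IN THE BLOCK-LAW SOCKET'S CURRENCY
# (Rogawski 1990 §4.9; Kottwitz 1986 §3; Bruhat–Tits 1972 §10)

Topic `NumberTheory/Rogawski1990`; namespace `Literature.NumberTheory.Rogawski1990.BlockLawAniso`.  THEOREMS ONLY (no definition, no instance, no notation, no named fact,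
no `sorry`); kernel lane `--supports stmt-HodgeConjecture-24833`.  Cell `pub/hodgecm-mathlib` (D-0151), crux H413; road «S3-ram» (Literature seeding, count-neutral); the
(Cnt2′) BLOCK-LAW skeleton of keeper F0P3a-p06 (g16) (v1.1, `F0/P3a/F0P3a-p06/g16/blocklaw/v1_1/`), cells `stub_Zaniso_zero_{even,odd}_B`, `stub_Zaniso_zero_even_A`,
`stub_Zpair_zero_odd_A` (composition pen A-p16 (g33), chair F0P3a-p07 (g15) RULING (13)(6)).

WHAT THIS FILE DOES (composition only — no census values, no new mathematics).  The block law's ANISOTROPIC literal is the element `Y = P₁·ι(γ₁, u_w)·P₁⁻¹` of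
`U(σ_w, Φ₃,w)` at a tame-ramified CM place `w ∣ v` (socket binders of the (Cnt2′) sockets: `γ_H = (g, u)` two-deep and `G`-regular, `m = v_F(χ_g(u))`, the frame `P₁ ∈ GL₃(𝒪_w)`
with `ᵗσ̄P₁ Φ₃ P₁ = diag d ⊕ η` residually anisotropic, `γ₁ ∈ U(σ_w, diag d)` with `χ_{γ₁} = χ_{g_w}` rootless).  Its row-`0` count `#{M ∣ M self-dual, Y·M = M, (Y − 1)M ⊆ ϖ²M}`
is delivered by the ★ route-B singleton head at the CENTRED literal `γ′ = P₁·ι(s·γ₁, 1)·P₁⁻¹` (`s·u_w = 1`; ★ p849074) whose root depth is EXACTLY `m`: the socket's `hm`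
and the spectral tie give `|det(γ₁ − u_w·1)|_w = |χ_{γ₁}(u_w)|_w = |χ_g(u)|_w = |ϖ|^{2m}` (§1), conformality of `γ₁ − u_w·1` (★ p849115) turns this ONE equality into the head's
entrywise depth `hBm ∕ hroot` and non-contraction `hA′` inputs (★ p849100, every regime), and the `2`-deep unit central rescaling `Y ↦ γ′` does not change the depth-`≤ 2`
strata sets (★ `setOf_strata_eq_of_coe_eq_smul`).  The CM dress (`K := L_w`, `σ := σ_w`: involutive, valuation-preserving, residually trivial, `|2|_w = 1`, norms of `σ_w`-fixed
principal units, `#𝓀_w = N(v)`, `Φ₃,w = J₃`) is the tree's standard one (★ `ramifiedBlock_adicCompletion`, ★ `natCard_residueField_eq_of_ramified`, ★ `placeForm_antidiagOne`);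
the residual non-square `ε` the head wants is the socket's own `η` (§1 `valued_sq_sub_eq_one_of_not_exists_norm`: a `σ`-fixed unit non-norm is a residual non-square).
RESULT (§2): **`anisotropicTotal_zero_ram_of_census_odd`** (root depth `m = 2mA + 3`, census atoms `NE NP NM` = the ★ odd head's collar-label counts AT `γ′`, class constant any
unit `c`) : `(#B : ℂ) = 1 + NE·(Σ_{i<mA+1} q^{2i} + Σ_{i<mA} q^{2mA+1+i}) + NP·Σ_{i<mA} q^{2i} + NM·Σ_{i<mA} q^{2i}` (the EVEN-depth twin `anisotropicTotal_zero_ram_of_census_even`, `m = 2mA + 2`, atoms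
`NE NO NP NM` of the ★ even head, is the sibling file `…AnisotropicTotalsEven`) — `#B` the socket's set-builder VERBATIM, `q = (Ideal.absNorm v.asIdeal : ℂ)`.  The keeper's cells are these plus the census VALUES
(organ (5): F0P2-p01 (g16) ∕ F0P3a-p04 (g20) ∕ F0P3a-p02 (g18)) and ★ `BlockLawArith.zero_*_census` (F0P3a-p03 (g18)).
HONEST LABEL: HC_CM is proved only modulo the 2 remaining named inputs (hLiu418 24832, h413 24833) until rung 0 closes; nothing printed is asserted here (bookkeeping between
★ theorems); «S3-ram» has no books consequence.

## References
* [Rogawski1990] J. D. Rogawski, *Automorphic Representations of Unitary Groups in Three Variables*, Ann. of Math. Stud. 123 (1990), §4.8 Case (a) p. 53, §4.9 Prop. 4.9.1 (a) p. 55, Lemma 4.9.3.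
* [Kottwitz1986] R. E. Kottwitz, *Base change for unit elements of Hecke algebras*, Compositio Math. 60 (1986), §3 (counting fixed lattices; central modifications).
* [BruhatTits1972] F. Bruhat, J. Tits, *Groupes réductifs sur un corps local I*, Publ. Math. IHÉS 41 (1972), §10.
* [Serre1979] J.-P. Serre, *Local Fields*, GTM 67 (1979), Ch. V §3 (tame quadratic extensions: unit norms and residue squares).
-/

set_option autoImplicit false

noncomputable section

open NumberField IsDedekindDomain Matrix Polynomial ValuativeRel
open Literature.NumberTheory.Automorphic Literature.NumberTheory.Automorphic.UnitaryGroup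
open Literature.NumberTheory.Automorphic.UnitaryLatticeTree Literature.NumberTheory.Automorphic.HermitianLattice
open Literature.NumberTheory.GaloisRepresentations
open Literature.NumberTheory.Rogawski1990 Literature.NumberTheory.Rogawski1990.TypeOneRamifiedJunction
open scoped Matrix MatrixGroups ValuativeRel WithZero

/-! ## §1 Two generic lemmas and the socket-side depth equality -/

namespace Literature.NumberTheory.Automorphic.UnitaryLatticeTree

/-- **A `σ`-FIXED UNIT NON-NORM IS A RESIDUAL NON-SQUARE**: for `σ` involutive, valuation-preserving and residually trivial, with norms of `σ`-fixed principal units (`hnorm`),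
a `σ`-fixed unit `η ∉ N(K^×)` satisfies `|z² − η| = 1` for every `|z| ≤ 1` (else `η ∕ (zσz)` is a `σ`-fixed principal unit, hence a norm).  This is the residual non-square
`ε` the route-B heads want, read off the block law's own `η`. [cite: Serre1979, Ch. V §3] -/
theorem valued_sq_sub_eq_one_of_not_exists_norm {K : Type*} [Field K] [Valued K ℤᵐ⁰] {σ : K →+* K}
    (hσ : ∀ x, σ (σ x) = x) (hvσ : ∀ a, Valued.v (σ a) = Valued.v a)
    (hres : ∀ x : K, Valued.v x ≤ 1 → Valued.v (σ x - x) < 1)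
    (hnorm : ∀ u : K, σ u = u → Valued.v (u - 1) < 1 → ∃ z : K, z * σ z = u ∧ Valued.v (z - 1) ≤ Valued.v (u - 1))
    {η : K} (hησ : σ η = η) (hηv : Valued.v η = 1) (hηN : ¬ ∃ t : K, t * σ t = η) :
    ∀ z : K, Valued.v z ≤ 1 → Valued.v (z ^ 2 - η) = 1 := by
  intro z hz
  have hle : Valued.v (z ^ 2 - η) ≤ 1 := by
    refine (Valuation.map_sub _ _ _).trans (max_le ?_ hηv.le)
    rw [map_pow]; exact pow_le_one₀ zero_le hz
  refine hle.antisymm (not_lt.1 fun hlt => hηN ?_)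
  have hz1 : Valued.v z = 1 := by
    by_contra hne
    have hzlt : Valued.v z < 1 := lt_of_le_of_ne hz hne
    have h2 : Valued.v (z ^ 2) < Valued.v η := by
      rw [map_pow, hηv]; exact pow_lt_one₀ zero_le hzlt two_ne_zero
    rw [Valuation.map_sub_eq_of_lt_right _ h2, hηv] at hlt
    exact lt_irrefl _ hlt
  have hz0 : z ≠ 0 := fun h => by rw [h, map_zero] at hz1; exact zero_ne_one hz1
  have hzσ0 : z * σ z ≠ 0 := mul_ne_zero hz0 (fun h => hz0 (by rw [← hσ z, h, map_zero]))
  have hN : Valued.v (z * σ z - η) < 1 := by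
    have e : z * σ z - η = z * (σ z - z) + (z ^ 2 - η) := by ring
    rw [e]
    refine Valuation.map_add_lt _ ?_ hlt
    rw [map_mul, hz1, one_mul]; exact hres z hz
  have hvzz : Valued.v (z * σ z) = 1 := by rw [map_mul, hvσ, hz1, one_mul]
  have hu1 : Valued.v (η / (z * σ z) - 1) < 1 := by
    rw [div_sub_one hzσ0, map_div₀, hvzz, div_one, ← Valuation.map_neg, neg_sub]; exact hN
  have huσ : σ (η / (z * σ z)) = η / (z * σ z) := by rw [map_div₀, hησ, map_mul, hσ, mul_comm]
  obtain ⟨t, ht, -⟩ := hnorm _ huσ hu1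
  refine ⟨t * z, ?_⟩
  rw [map_mul, show t * z * (σ t * σ z) = (t * σ t) * (z * σ z) by ring, ht, div_mul_cancel₀ η hzσ0]

/-- `|s| = 1` and `s·t = 1` move the entrywise size of `A − t·1` to `s·A − 1` EXACTLY (both ways; `s·A − 1 = s·(A − t·1)`). [cite: Kottwitz1986, §3] -/
theorem v_smul_sub_one_apply_eq_of_mul_eq_one {K : Type*} [Field K] [Valued K ℤᵐ⁰] {N : ℕ} (A : Matrix (Fin N) (Fin N) K) {s t : K} (hst : s * t = 1)
    (hs : Valued.v s = 1) (i j : Fin N) :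
    Valued.v ((s • A - 1) i j) = Valued.v ((A - t • (1 : Matrix (Fin N) (Fin N) K)) i j) := by
  have e : s • A - 1 = s • (A - t • (1 : Matrix (Fin N) (Fin N) K)) := by
    rw [smul_sub, smul_smul, hst, one_smul]
  rw [e, Matrix.smul_apply, smul_eq_mul, map_mul, hs, one_mul]

end Literature.NumberTheory.Automorphic.UnitaryLatticeTree

namespace Literature.NumberTheory.Rogawski1990.BlockLawAniso

variable (L : Type) [Field L] [NumberField L] [IsCMField L] {v : HeightOneSpectrum (𝓞 ↥(maximalRealSubfield L))}

/-- **THE ROOT DEPTH OF THE ANISOTROPIC LITERAL IS THE SOCKET'S `m`**: the socket token `|χ_g(u)|_w = |ι_w π_v^m|_w` and the spectral tie `χ_{γ₁} = χ_{g_w}` give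
`|det(γ₁ − u_w·1)|_w = |ϖ|^{2m}` (`det(A − c·1) = χ_A(c)` for `2 × 2`, ★ `eval_charpoly_fin_two_eq_det_sub_smul_one`; `χ_{g_w} = χ_g` read at `w`, Mathlib
`Matrix.charpoly_map`; `|ι_w π_v| = |ϖ|²`, ★ `valued_toPlace_eq_pow_two_of_ramified`). [cite: Rogawski1990, §4.9 p. 55] [cite: Kottwitz1986, §3] -/
theorem valued_det_sub_smul_one_eq_of_tokens (w : PlacesOver L v)
    (hw : IsCMField.complexConj L • w.1 = w.1) (he : v.asIdeal.ramificationIdx' w.1.asIdeal ≠ 1)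
    (ϖ : w.1.adicCompletion L) (hϖ : Valued.v ϖ = WithZero.exp (-1 : ℤ))
    (γH : ((cmDatum L 2 (Matrix.of fun i j : Fin 2 => if i.val + j.val + 1 = 2 then (1 : L) else 0)).Local v ×
      (cmDatum L 1 (Matrix.of fun i j : Fin 1 => if i.val + j.val + 1 = 1 then (1 : L) else 0)).Local v))
    (m : ℕ) (hm : Valued.v (((finCharpolyTwo L v γH).eval (finGammaTwo L v γH)) w) =
          Valued.v ((toPlace v w (HeckeCharacter.uniformizer ↥(maximalRealSubfield L) v : v.adicCompletion ↥(maximalRealSubfield L))) ^ m))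
    (γ₁ : GL (Fin 2) (w.1.adicCompletion L))
    (hχ : (γ₁ : Matrix (Fin 2) (Fin 2) (w.1.adicCompletion L)).charpoly = (((γH.1.val : GL (Fin 2) (UnitaryGroup.LocalRing L v)).val.map (Pi.evalRingHom (fun w' : PlacesOver L v => w'.1.adicCompletion L) w))).charpoly) :
    Valued.v (((γ₁ : Matrix (Fin 2) (Fin 2) (w.1.adicCompletion L)) -
        (((localNonsplitEquiv (IsCMField.complexConj L) (Matrix.of fun i j : Fin 1 => if i.val + j.val + 1 = 1 then (1 : L) else 0) (IsCMField.complexConj_ne_one L) w hw γH.2).val : GL (Fin 1) (w.1.adicCompletion L)) : Matrix (Fin 1) (Fin 1) (w.1.adicCompletion L)) 0 0 •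
          (1 : Matrix (Fin 2) (Fin 2) (w.1.adicCompletion L))).det) = Valued.v ϖ ^ (2 * m) := by
  have hc1 : IsCMField.complexConj L ≠ 1 := IsCMField.complexConj_ne_one L
  have hu : (((localNonsplitEquiv (IsCMField.complexConj L) (Matrix.of fun i j : Fin 1 => if i.val + j.val + 1 = 1 then (1 : L) else 0) (IsCMField.complexConj_ne_one L) w hw γH.2).val : GL (Fin 1) (w.1.adicCompletion L)) : Matrix (Fin 1) (Fin 1) (w.1.adicCompletion L)) 0 0 = finGammaTwo L v γH w := rfl
  have hev : ((finCharpolyTwo L v γH).eval (finGammaTwo L v γH)) w =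
      ((γ₁ : Matrix (Fin 2) (Fin 2) (w.1.adicCompletion L)).charpoly).eval (finGammaTwo L v γH w) := by
    rw [hχ, Matrix.charpoly_map]
    change Pi.evalRingHom (fun w' : PlacesOver L v => w'.1.adicCompletion L) w ((finCharpolyTwo L v γH).eval (finGammaTwo L v γH)) =
      ((finCharpolyTwo L v γH).map (Pi.evalRingHom (fun w' : PlacesOver L v => w'.1.adicCompletion L) w)).eval
        (Pi.evalRingHom (fun w' : PlacesOver L v => w'.1.adicCompletion L) w (finGammaTwo L v γH))
    rw [Polynomial.eval_map, Polynomial.eval₂_at_apply]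
  rw [hu, ← eval_charpoly_fin_two_eq_det_sub_smul_one, ← hev, hm, map_pow,
    valued_toPlace_eq_pow_two_of_ramified (IsCMField.complexConj L) w hc1 hw he, HeckeCharacter.valued_uniformizer, hϖ, ← pow_mul]

set_option maxHeartbeats 1600000 in
-- budget only: statement-heavy lattice tokens (verbatim the ★ route-B head's budget); the proof is a composition.
/-- **ODD ROOT DEPTH `m = 2mA + 3` — THE ROW-`0` TOTAL OF THE ANISOTROPIC LITERAL IN THE SOCKET'S CURRENCY.**  From the (Cnt2′) socket ∕ block-law binders (`hu2`, `hm`, the frame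
`P₁`, `hform`, the anisotropy `han₀ han₁`, `η` a `σ_w`-fixed unit non-norm, `γ₁` two-deep unitary with the spectral tie `hχ` and rootless `hirrγ`), a centring unit `s`
(`s·u_w = 1`), the centred literal `γ′ = P₁·ι(s·γ₁, 1)·P₁⁻¹ ∈ U(σ_w, J₃)` and the census atoms `NE NP NM` (the ★ head's collar-label counts of the root AT `γ′`, level `m`,
class constant any unit `c`): the socket's count `#{M ∣ SD(Φ₃,w) M, Y·M = M, (Y − 1)M ⊆ ϖ²M}` for `Y = P₁·ι(γ₁, u_w)·P₁⁻¹`, cast to `ℂ`, in closed form with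
`q = (Ideal.absNorm v.asIdeal : ℂ)`.  ★ `strataCount_J₀_of_charpoly_block_raw_singleton_of_anisotropic_frame_of_entry` ∘ §1 ∘ ★ p849074 ∘ ★ p849115. [cite: Rogawski1990, §4.9 Prop. 4.9.1 (a) p. 55, Lemma 4.9.3]
[cite: Kottwitz1986, §3] [cite: BruhatTits1972, §10] -/
theorem anisotropicTotal_zero_ram_of_census_odd (w : PlacesOver L v)
    (hw : IsCMField.complexConj L • w.1 = w.1) (he : v.asIdeal.ramificationIdx' w.1.asIdeal ≠ 1)
    (h2 : IsUnit (2 : 𝒪[(w.1.adicCompletion L)]))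
    (ϖ : w.1.adicCompletion L) (hϖ : Valued.v ϖ = WithZero.exp (-1 : ℤ)) (hσϖ : galAdicCompletionMap (L := L) (IsCMField.complexConj L) hw ϖ = -ϖ)
    (γH : ((cmDatum L 2 (Matrix.of fun i j : Fin 2 => if i.val + j.val + 1 = 2 then (1 : L) else 0)).Local v ×
      (cmDatum L 1 (Matrix.of fun i j : Fin 1 => if i.val + j.val + 1 = 1 then (1 : L) else 0)).Local v))
    (hu2 : Valued.v (finGammaTwo L v γH w - 1) ≤ Valued.v (ϖ ^ 2))
    (m : ℕ) (hm : Valued.v (((finCharpolyTwo L v γH).eval (finGammaTwo L v γH)) w) =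
          Valued.v ((toPlace v w (HeckeCharacter.uniformizer ↥(maximalRealSubfield L) v : v.adicCompletion ↥(maximalRealSubfield L))) ^ m))
    (P₁ : GL (Fin 3) (w.1.adicCompletion L)) (d : Fin 2 → (w.1.adicCompletion L)) (η : (w.1.adicCompletion L)) (γ₁ : GL (Fin 2) (w.1.adicCompletion L))
    (hP₁ : P₁ ∈ glInt 3 (w.1.adicCompletion L))
    (hform : formCongr (galAdicCompletionMap (L := L) (IsCMField.complexConj L) hw) P₁ (placeForm (Matrix.of fun i j : Fin 3 => if i.val + j.val + 1 = 3 then (1 : L) else 0) w.1) = !![(Matrix.diagonal d) 0 0, 0, (Matrix.diagonal d) 0 1; 0, η, 0; (Matrix.diagonal d) 1 0, 0, (Matrix.diagonal d) 1 1])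
    (hd : ∀ i, Valued.v (d i) = 1) (hσd : ∀ i, (galAdicCompletionMap (L := L) (IsCMField.complexConj L) hw) (d i) = d i)
    (han₀ : ∀ z : (w.1.adicCompletion L), Valued.v z ≤ 1 → Valued.v (d 0 + d 1 * ((galAdicCompletionMap (L := L) (IsCMField.complexConj L) hw) z * z)) = 1)
    (han₁ : ∀ z : (w.1.adicCompletion L), Valued.v z ≤ 1 → Valued.v (d 0 * ((galAdicCompletionMap (L := L) (IsCMField.complexConj L) hw) z * z) + d 1) = 1)
    (hση : (galAdicCompletionMap (L := L) (IsCMField.complexConj L) hw) η = η) (hηv : Valued.v η = 1)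
    (hγ2 : ∀ i j, Valued.v (((γ₁ : Matrix (Fin 2) (Fin 2) (w.1.adicCompletion L)) - 1) i j) ≤ Valued.v (ϖ ^ 2))
    (hγU : γ₁ ∈ unitaryGroupOfForm (galAdicCompletionMap (L := L) (IsCMField.complexConj L) hw) (Matrix.diagonal d))
    (hχ : (γ₁ : Matrix (Fin 2) (Fin 2) (w.1.adicCompletion L)).charpoly = (((γH.1.val : GL (Fin 2) (UnitaryGroup.LocalRing L v)).val.map (Pi.evalRingHom (fun w' : PlacesOver L v => w'.1.adicCompletion L) w))).charpoly)
    (hirrγ : ¬ ∃ x : (w.1.adicCompletion L), ((γ₁ : Matrix (Fin 2) (Fin 2) (w.1.adicCompletion L)).charpoly).IsRoot x)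
    (hηN : ¬ ∃ t : (w.1.adicCompletion L), t * (galAdicCompletionMap (L := L) (IsCMField.complexConj L) hw) t = η)
    (mA : ℕ) (hmA : m = 2 * mA + 3)
    (s : (w.1.adicCompletion L)ˣ) (hs : (s : w.1.adicCompletion L) * finGammaTwo L v γH w = 1)
    (γ' : unitaryGroupOfForm (galAdicCompletionMap (L := L) (IsCMField.complexConj L) hw) ((StdForm.antidiagonal 3).over (w.1.adicCompletion L)))
    (hγ' : (γ' : GL (Fin 3) (w.1.adicCompletion L)) = P₁ * endoGL (Matrix.GeneralLinearGroup.scalar (Fin 2) s * γ₁, (1 : GL (Fin 1) (w.1.adicCompletion L))) * P₁⁻¹)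
    (c : w.1.adicCompletion L) (hc : Valued.v c = 1)
    (NE NP NM : ℕ)
    (hNE : ({x | x ∈ {x | ∃ p, ((latticeGraph (galAdicCompletionMap (L := L) (IsCMField.complexConj L) hw) ϖ ((StdForm.antidiagonal 3).over (w.1.adicCompletion L))).Adj (⟨stdLattice (w.1.adicCompletion L) 3, 0, isSelfDualLattice_stdLattice_three_of_v hϖ⟩ : {M : Submodule (Valued.integer (w.1.adicCompletion L)) (Fin 3 → (w.1.adicCompletion L)) // IsVertex (galAdicCompletionMap (L := L) (IsCMField.complexConj L) hw) ϖ ((StdForm.antidiagonal 3).over (w.1.adicCompletion L)) M}) p ∧ (latticeGraph (galAdicCompletionMap (L := L) (IsCMField.complexConj L) hw) ϖ ((StdForm.antidiagonal 3).over (w.1.adicCompletion L))).dist ⟨stdLattice (w.1.adicCompletion L) 3, 0, isSelfDualLattice_stdLattice_three_of_v hϖ⟩ p = (latticeGraph (galAdicCompletionMap (L := L) (IsCMField.complexConj L) hw) ϖ ((StdForm.antidiagonal 3).over (w.1.adicCompletion L))).dist ⟨stdLattice (w.1.adicCompletion L) 3, 0, isSelfDualLattice_stdLattice_three_of_v hϖ⟩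 (⟨stdLattice (w.1.adicCompletion L) 3, 0, isSelfDualLattice_stdLattice_three_of_v hϖ⟩ : {M : Submodule (Valued.integer (w.1.adicCompletion L)) (Fin 3 → (w.1.adicCompletion L)) // IsVertex (galAdicCompletionMap (L := L) (IsCMField.complexConj L) hw) ϖ ((StdForm.antidiagonal 3).over (w.1.adicCompletion L)) M}) + 1 ∧ latticeGraphIso (galAdicCompletionMap (L := L) (IsCMField.complexConj L) hw) ϖ ((StdForm.antidiagonal 3).over (w.1.adicCompletion L)) γ' p = p) ∧ ((latticeGraph (galAdicCompletionMap (L := L) (IsCMField.complexConj L) hw) ϖ ((StdForm.antidiagonal 3).over (w.1.adicCompletion L))).Adj p x ∧ (latticeGraph (galAdicCompletionMap (L := L) (IsCMField.complexConj L) hw) ϖ ((StdForm.antidiagonal 3).over (w.1.adicCompletion L))).dist ⟨stdLattice (w.1.adicCompletion L) 3, 0, isSelfDualLattice_stdLattice_three_of_v hϖ⟩ x = (latticeGraph (galAdicCompletionMap (L := L) (IsCMField.complexConj L) hw) ϖ ((StdForm.antidiagonal 3).over (w.1.adicCompletion L))).dist ⟨stdLattice (w.1.adicCompletion L) 3, 0,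 isSelfDualLattice_stdLattice_three_of_v hϖ⟩ p + 1 ∧ latticeGraphIso (galAdicCompletionMap (L := L) (IsCMField.complexConj L) hw) ϖ ((StdForm.antidiagonal 3).over (w.1.adicCompletion L)) γ' x = x)} ∧ (¬ x.1.map ((Matrix.toLin' (((γ' : GL (Fin 3) (w.1.adicCompletion L)) : Matrix (Fin 3) (Fin 3) (w.1.adicCompletion L)) - 1)).restrictScalars (Valued.integer (w.1.adicCompletion L))) ≤ scaleLattice (ϖ ^ m) x.1 ∧ (x.1.map ((Matrix.toLin' (((γ' : GL (Fin 3) (w.1.adicCompletion L)) : Matrix (Fin 3) (Fin 3) (w.1.adicCompletion L)) - 1)).restrictScalars (Valued.integer (w.1.adicCompletion L))) ≤ scaleLattice (ϖ ^ (m - 1)) x.1 ∧ ¬ x.1.map ((Matrix.toLin' (((γ' : GL (Fin 3) (w.1.adicCompletion L)) : Matrix (Fin 3) (Fin 3) (w.1.adicCompletion L)) - 1)).restrictScalars (Valued.integer (w.1.adicCompletion L))) ≤ scaleLattice (ϖ ^ m) x.1))}).ncard = NE)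
    (hNP : ({x | x ∈ {x | ∃ p, ((latticeGraph (galAdicCompletionMap (L := L) (IsCMField.complexConj L) hw) ϖ ((StdForm.antidiagonal 3).over (w.1.adicCompletion L))).Adj (⟨stdLattice (w.1.adicCompletion L) 3, 0, isSelfDualLattice_stdLattice_three_of_v hϖ⟩ : {M : Submodule (Valued.integer (w.1.adicCompletion L)) (Fin 3 → (w.1.adicCompletion L)) // IsVertex (galAdicCompletionMap (L := L) (IsCMField.complexConj L) hw) ϖ ((StdForm.antidiagonal 3).over (w.1.adicCompletion L)) M}) p ∧ (latticeGraph (galAdicCompletionMap (L := L) (IsCMField.complexConj L) hw) ϖ ((StdForm.antidiagonal 3).over (w.1.adicCompletion L))).dist ⟨stdLattice (w.1.adicCompletion L) 3, 0, isSelfDualLattice_stdLattice_three_of_v hϖ⟩ p = (latticeGraph (galAdicCompletionMap (L := L) (IsCMField.complexConj L) hw) ϖ ((StdForm.antidiagonal 3).over (w.1.adicCompletion L))).dist ⟨stdLattice (w.1.adicCompletion L) 3, 0, isSelfDualLattice_stdLattice_three_of_v hϖ⟩ (⟨stdLattice (w.1.adicCompletion L) 3, 0, isSelfDualLattice_stdLattice_three_of_v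 hϖ⟩ : {M : Submodule (Valued.integer (w.1.adicCompletion L)) (Fin 3 → (w.1.adicCompletion L)) // IsVertex (galAdicCompletionMap (L := L) (IsCMField.complexConj L) hw) ϖ ((StdForm.antidiagonal 3).over (w.1.adicCompletion L)) M}) + 1 ∧ latticeGraphIso (galAdicCompletionMap (L := L) (IsCMField.complexConj L) hw) ϖ ((StdForm.antidiagonal 3).over (w.1.adicCompletion L)) γ' p = p) ∧ ((latticeGraph (galAdicCompletionMap (L := L) (IsCMField.complexConj L) hw) ϖ ((StdForm.antidiagonal 3).over (w.1.adicCompletion L))).Adj p x ∧ (latticeGraph (galAdicCompletionMap (L := L) (IsCMField.complexConj L) hw) ϖ ((StdForm.antidiagonal 3).over (w.1.adicCompletion L))).dist ⟨stdLattice (w.1.adicCompletion L) 3, 0, isSelfDualLattice_stdLattice_three_of_v hϖ⟩ x = (latticeGraph (galAdicCompletionMap (L := L) (IsCMField.complexConj L) hw) ϖ ((StdForm.antidiagonal 3).over (w.1.adicCompletion L))).dist ⟨stdLattice (w.1.adicCompletion L) 3, 0, isSelfDualLattice_stdLattice_three_of_v hϖ⟩ p + 1 ∧ latticeGraphIso (galAdicCompletionMap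 (L := L) (IsCMField.complexConj L) hw) ϖ ((StdForm.antidiagonal 3).over (w.1.adicCompletion L)) γ' x = x)} ∧ (¬ x.1.map ((Matrix.toLin' (((γ' : GL (Fin 3) (w.1.adicCompletion L)) : Matrix (Fin 3) (Fin 3) (w.1.adicCompletion L)) - 1)).restrictScalars (Valued.integer (w.1.adicCompletion L))) ≤ scaleLattice (ϖ ^ m) x.1 ∧ (x.1.map ((Matrix.toLin' (((γ' : GL (Fin 3) (w.1.adicCompletion L)) : Matrix (Fin 3) (Fin 3) (w.1.adicCompletion L)) - 1)).restrictScalars (Valued.integer (w.1.adicCompletion L))) ≤ scaleLattice (ϖ ^ (m - 2)) x.1 ∧ ¬ x.1.map ((Matrix.toLin' (((γ' : GL (Fin 3) (w.1.adicCompletion L)) : Matrix (Fin 3) (Fin 3) (w.1.adicCompletion L)) - 1)).restrictScalars (Valued.integer (w.1.adicCompletion L))) ≤ scaleLattice (ϖ ^ (m - 1)) x.1) ∧ ∃ y ∈ x.1, ∃ a : (w.1.adicCompletion L), Valued.v a = 1 ∧ Valued.v ((ϖ ^ (m - 2))⁻¹ * pairing (galAdicCompletionMap (L := L) (IsCMField.complexConj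 L) hw) ((StdForm.antidiagonal 3).over (w.1.adicCompletion L)) y ((((γ' : GL (Fin 3) (w.1.adicCompletion L)) : Matrix (Fin 3) (Fin 3) (w.1.adicCompletion L)) - 1) *ᵥ y) - (c) * a ^ 2) < 1)}).ncard = NP)
    (hNM : ({x | x ∈ {x | ∃ p, ((latticeGraph (galAdicCompletionMap (L := L) (IsCMField.complexConj L) hw) ϖ ((StdForm.antidiagonal 3).over (w.1.adicCompletion L))).Adj (⟨stdLattice (w.1.adicCompletion L) 3, 0, isSelfDualLattice_stdLattice_three_of_v hϖ⟩ : {M : Submodule (Valued.integer (w.1.adicCompletion L)) (Fin 3 → (w.1.adicCompletion L)) // IsVertex (galAdicCompletionMap (L := L) (IsCMField.complexConj L) hw) ϖ ((StdForm.antidiagonal 3).over (w.1.adicCompletion L)) M}) p ∧ (latticeGraph (galAdicCompletionMap (L := L) (IsCMField.complexConj L) hw) ϖ ((StdForm.antidiagonal 3).over (w.1.adicCompletion L))).dist ⟨stdLattice (w.1.adicCompletion L) 3, 0, isSelfDualLattice_stdLattice_three_of_v hϖ⟩ p = (latticeGraph (galAdicCompletionMap (L := L) (IsCMField.complexConj L)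 hw) ϖ ((StdForm.antidiagonal 3).over (w.1.adicCompletion L))).dist ⟨stdLattice (w.1.adicCompletion L) 3, 0, isSelfDualLattice_stdLattice_three_of_v hϖ⟩ (⟨stdLattice (w.1.adicCompletion L) 3, 0, isSelfDualLattice_stdLattice_three_of_v hϖ⟩ : {M : Submodule (Valued.integer (w.1.adicCompletion L)) (Fin 3 → (w.1.adicCompletion L)) // IsVertex (galAdicCompletionMap (L := L) (IsCMField.complexConj L) hw) ϖ ((StdForm.antidiagonal 3).over (w.1.adicCompletion L)) M}) + 1 ∧ latticeGraphIso (galAdicCompletionMap (L := L) (IsCMField.complexConj L) hw) ϖ ((StdForm.antidiagonal 3).over (w.1.adicCompletion L)) γ' p = p) ∧ ((latticeGraph (galAdicCompletionMap (L := L) (IsCMField.complexConj L) hw) ϖ ((StdForm.antidiagonal 3).over (w.1.adicCompletion L))).Adj p x ∧ (latticeGraph (galAdicCompletionMap (L := L) (IsCMField.complexConj L) hw) ϖ ((StdForm.antidiagonal 3).over (w.1.adicCompletion L))).dist ⟨stdLattice (w.1.adicCompletion L) 3, 0, isSelfDualLattice_stdLattice_three_of_v hϖ⟩ x = (latticeGraph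 (galAdicCompletionMap (L := L) (IsCMField.complexConj L) hw) ϖ ((StdForm.antidiagonal 3).over (w.1.adicCompletion L))).dist ⟨stdLattice (w.1.adicCompletion L) 3, 0, isSelfDualLattice_stdLattice_three_of_v hϖ⟩ p + 1 ∧ latticeGraphIso (galAdicCompletionMap (L := L) (IsCMField.complexConj L) hw) ϖ ((StdForm.antidiagonal 3).over (w.1.adicCompletion L)) γ' x = x)} ∧ (¬ x.1.map ((Matrix.toLin' (((γ' : GL (Fin 3) (w.1.adicCompletion L)) : Matrix (Fin 3) (Fin 3) (w.1.adicCompletion L)) - 1)).restrictScalars (Valued.integer (w.1.adicCompletion L))) ≤ scaleLattice (ϖ ^ m) x.1 ∧ (x.1.map ((Matrix.toLin' (((γ' : GL (Fin 3) (w.1.adicCompletion L)) : Matrix (Fin 3) (Fin 3) (w.1.adicCompletion L)) - 1)).restrictScalars (Valued.integer (w.1.adicCompletion L))) ≤ scaleLattice (ϖ ^ (m - 2)) x.1 ∧ ¬ x.1.map ((Matrix.toLin' (((γ' : GL (Fin 3) (w.1.adicCompletion L)) : Matrix (Fin 3) (Fin 3) (w.1.adicCompletion L)) - 1)).restrictScalars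 (Valued.integer (w.1.adicCompletion L))) ≤ scaleLattice (ϖ ^ (m - 1)) x.1) ∧ ¬ (∃ y ∈ x.1, ∃ a : (w.1.adicCompletion L), Valued.v a = 1 ∧ Valued.v ((ϖ ^ (m - 2))⁻¹ * pairing (galAdicCompletionMap (L := L) (IsCMField.complexConj L) hw) ((StdForm.antidiagonal 3).over (w.1.adicCompletion L)) y ((((γ' : GL (Fin 3) (w.1.adicCompletion L)) : Matrix (Fin 3) (Fin 3) (w.1.adicCompletion L)) - 1) *ᵥ y) - (c) * a ^ 2) < 1))}).ncard = NM) :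
    ({M : Submodule (Valued.integer (w.1.adicCompletion L)) (Fin 3 → (w.1.adicCompletion L)) | IsSelfDualLattice (galAdicCompletionMap (L := L) (IsCMField.complexConj L) hw) ϖ (placeForm (Matrix.of fun i j : Fin 3 => if i.val + j.val + 1 = 3 then (1 : L) else 0) w.1) M ∧ mapGL (P₁ * endoGL (γ₁, ((localNonsplitEquiv (IsCMField.complexConj L) (Matrix.of fun i j : Fin 1 => if i.val + j.val + 1 = 1 then (1 : L) else 0) (IsCMField.complexConj_ne_one L) w hw γH.2).val : GL (Fin 1) (w.1.adicCompletion L))) * P₁⁻¹) M = M ∧ M.map ((Matrix.toLin' (((P₁ * endoGL (γ₁, ((localNonsplitEquiv (IsCMField.complexConj L) (Matrix.of fun i j : Fin 1 => if i.val + j.val + 1 = 1 then (1 : L) else 0) (IsCMField.complexConj_ne_one L) w hw γH.2).val : GL (Fin 1) (w.1.adicCompletion L))) * P₁⁻¹ : GL (Fin 3) (w.1.adicCompletion L)) : Matrix (Fin 3) (Fin 3) (w.1.adicCompletion L)) - 1)).restrictScalars (Valued.integer (w.1.adicCompletion L))) ≤ scaleLattice (ϖ ^ 2) M}.ncard : ℂ)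 =
      1 + (NE : ℂ) * (∑ i ∈ Finset.range (mA + 1), (Ideal.absNorm v.asIdeal : ℂ) ^ (2 * i) + ∑ i ∈ Finset.range mA, (Ideal.absNorm v.asIdeal : ℂ) ^ (2 * mA + 1 + i)) +
        (NP : ℂ) * ∑ i ∈ Finset.range mA, (Ideal.absNorm v.asIdeal : ℂ) ^ (2 * i) + (NM : ℂ) * ∑ i ∈ Finset.range mA, (Ideal.absNorm v.asIdeal : ℂ) ^ (2 * i) := by
  classical
  -- THE CM DRESS ⟶ the generic tame-ramified block hypotheses of the route-B heads
  have hc1 : IsCMField.complexConj L ≠ 1 := IsCMField.complexConj_ne_one L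
  have h2v : Valued.v (2 : (w.1.adicCompletion L)) = 1 := (isUnit_two_integer_iff_valued_eq_one L w.1).1 h2
  have hσσ : ∀ z : (w.1.adicCompletion L), (galAdicCompletionMap (L := L) (IsCMField.complexConj L) hw) ((galAdicCompletionMap (L := L) (IsCMField.complexConj L) hw) z) = z :=
    galAdicCompletionMap_galAdicCompletionMap_of_smul_eq (IsCMField.complexConj L) w hc1 hw
  have hvσ : ∀ z : (w.1.adicCompletion L), Valued.v ((galAdicCompletionMap (L := L) (IsCMField.complexConj L) hw) z) = Valued.v z := fun z =>
    valued_galAdicCompletionMap (L := L) (IsCMField.complexConj L) hw z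
  obtain ⟨-, -, -, hres, hnorm⟩ := ramifiedBlock_adicCompletion L v w hw he h2v
  haveI : Fintype (Valued.ResidueField (w.1.adicCompletion L)) := Fintype.ofFinite _
  haveI := isPrincipalIdealRing_integer_adicCompletion L v w
  have hq : (Fintype.card (Valued.ResidueField (w.1.adicCompletion L)) : ℂ) = (Ideal.absNorm v.asIdeal : ℂ) := by
    congr 1
    rw [Fintype.card_eq_nat_card, ← natCard_residueField_eq_of_compatible, natCard_residueField_eq_of_ramified (IsCMField.complexConj L) v hc1 w hw he,
      Ideal.absNorm_apply, Submodule.cardQuot_apply]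
  have hsq : ∀ t : (w.1.adicCompletion L), Valued.v (t - 1) < 1 → IsSquare t := fun t ht => by
    obtain ⟨r, hr, -⟩ := exists_sq_eq_of_valued_sub_one_lt w.1 h2v t ht
    exact ⟨r, by rw [← hr, sq]⟩
  have hε := valued_sq_sub_eq_one_of_not_exists_norm hσσ hvσ hres hnorm hση hηv hηN
  have hϖ0 : ϖ ≠ 0 := fun h0 => by rw [h0, Valuation.map_zero] at hϖ; exact WithZero.exp_ne_zero hϖ.symm
  have hϖ2 : Valued.v (ϖ ^ 2) = Valued.v ϖ ^ 2 := map_pow _ _ _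
  have hϖlt : Valued.v ϖ < 1 := by rw [hϖ, ← WithZero.exp_zero]; exact WithZero.exp_lt_exp.2 (by norm_num)
  -- the middle eigenvalue `u_w`: norm one, `2`-deep; the centring unit `s`
  have hu00 : (((localNonsplitEquiv (IsCMField.complexConj L) (Matrix.of fun i j : Fin 1 => if i.val + j.val + 1 = 1 then (1 : L) else 0) (IsCMField.complexConj_ne_one L) w hw γH.2).val : GL (Fin 1) (w.1.adicCompletion L)) : Matrix (Fin 1) (Fin 1) (w.1.adicCompletion L)) 0 0 = finGammaTwo L v γH w := rfl
  have huu : (galAdicCompletionMap (L := L) (IsCMField.complexConj L) hw) (finGammaTwo L v γH w) * finGammaTwo L v γH w = 1 := by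
    have h := congrArg (fun y : LocalRing L v => y w) (conjLocal_finGammaTwo_mul_finGammaTwo L v γH)
    simpa only [Pi.mul_apply, Pi.one_apply, conjLocal_apply_eq_galAdicCompletionMap L v w hw] using h
  have huv : Valued.v (finGammaTwo L v γH w) = 1 := v_eq_one_of_mul_map_eq_one hvσ (by rw [mul_comm]; exact huu)
  have hu2' : Valued.v (finGammaTwo L v γH w - 1) ≤ Valued.v ϖ ^ 2 := by rw [← hϖ2]; exact hu2
  have hsnorm : (galAdicCompletionMap (L := L) (IsCMField.complexConj L) hw) (s : (w.1.adicCompletion L)) * (s : (w.1.adicCompletion L)) = 1 :=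
    norm_eq_one_of_mul_eq_one_of_norm_eq_one huu hs
  obtain ⟨hsv, hs1⟩ := v_eq_one_and_v_sub_one_le_of_mul_eq_one huv hu2' hs
  have hs' : (s : (w.1.adicCompletion L)) * (((localNonsplitEquiv (IsCMField.complexConj L) (Matrix.of fun i j : Fin 1 => if i.val + j.val + 1 = 1 then (1 : L) else 0) (IsCMField.complexConj_ne_one L) w hw γH.2).val : GL (Fin 1) (w.1.adicCompletion L)) : Matrix (Fin 1) (Fin 1) (w.1.adicCompletion L)) 0 0 = 1 := by
    rw [hu00]; exact hs
  -- the frame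
  have hform' : formCongr (galAdicCompletionMap (L := L) (IsCMField.complexConj L) hw) P₁ ((StdForm.antidiagonal 3).over (w.1.adicCompletion L)) =
      !![(Matrix.diagonal d) 0 0, 0, (Matrix.diagonal d) 0 1; 0, η, 0; (Matrix.diagonal d) 1 0, 0, (Matrix.diagonal d) 1 1] := by
    rw [← placeForm_antidiagOne]; exact hform
  obtain ⟨hPint, hPinv⟩ := isIntMatrix_and_isIntMatrix_inv_of_mem_glInt hP₁
  have hP0 : mapGL P₁ (stdLattice (w.1.adicCompletion L) 3) = stdLattice (w.1.adicCompletion L) 3 := (mapGL_stdLattice_eq_iff P₁).2 ⟨hPint, hPinv⟩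
  -- the block: unitary, rootless, integral; the depth `m` from the socket (conformality turns `|det| = |ϖ|^(2m)` into entrywise bounds)
  have hU : (((γ₁ : Matrix (Fin 2) (Fin 2) (w.1.adicCompletion L))).map (galAdicCompletionMap (L := L) (IsCMField.complexConj L) hw))ᵀ * Matrix.diagonal d *
      (γ₁ : Matrix (Fin 2) (Fin 2) (w.1.adicCompletion L)) = Matrix.diagonal d := hγU
  have hirr' : ∀ x : (w.1.adicCompletion L), ¬ ((γ₁ : Matrix (Fin 2) (Fin 2) (w.1.adicCompletion L)).charpoly).IsRoot x := fun x hx => hirrγ ⟨x, hx⟩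
  have hdet := valued_det_sub_smul_one_eq_of_tokens L w hw he ϖ hϖ γH m hm γ₁ hχ
  have hmm : Valued.v ϖ ^ (2 * m) = Valued.v ϖ ^ m * Valued.v ϖ ^ m := by rw [two_mul, pow_add]
  have hγd : ∀ i j, Valued.v (((γ₁ : Matrix (Fin 2) (Fin 2) (w.1.adicCompletion L)) - finGammaTwo L v γH w • (1 : Matrix (Fin 2) (Fin 2) (w.1.adicCompletion L))) i j) ≤ Valued.v ϖ ^ m :=
    forall_valued_sub_smul_one_apply_le_of_valued_det_le hvσ h2v hsq hd han₀ han₁ hU hirr' _ (by rw [← hu00, hdet, hmm])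
  have hA' : ∃ i j, Valued.v ϖ ^ m ≤ Valued.v (((γ₁ : Matrix (Fin 2) (Fin 2) (w.1.adicCompletion L)) - finGammaTwo L v γH w • (1 : Matrix (Fin 2) (Fin 2) (w.1.adicCompletion L))) i j) :=
    exists_le_valued_sub_smul_one_apply_of_le_valued_det hvσ h2v hsq hd han₀ han₁ hU hirr' _ (by rw [← hu00, hdet, hmm])
  have hγ₁int : ∀ i j, Valued.v ((γ₁ : Matrix (Fin 2) (Fin 2) (w.1.adicCompletion L)) i j) ≤ 1 :=
    isIntMatrix_of_forall_v_sub_one_le_of_lt_one (C := Valued.v (ϖ ^ 2)) (by rw [hϖ2]; exact pow_lt_one₀ zero_le hϖlt two_ne_zero) hγ2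
  -- the centred block `s·γ₁`
  have hcoe : ((Matrix.GeneralLinearGroup.scalar (Fin 2) s * γ₁ : GL (Fin 2) (w.1.adicCompletion L)) : Matrix (Fin 2) (Fin 2) (w.1.adicCompletion L)) =
      (s : (w.1.adicCompletion L)) • (γ₁ : Matrix (Fin 2) (Fin 2) (w.1.adicCompletion L)) := coe_scalar_mul_two_eq_smul s γ₁
  have hBm : ∀ i j, Valued.v ((((Matrix.GeneralLinearGroup.scalar (Fin 2) s * γ₁ : GL (Fin 2) (w.1.adicCompletion L)) : Matrix (Fin 2) (Fin 2) (w.1.adicCompletion L)) - 1) i j) ≤ Valued.v ϖ ^ m := fun i j => by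
    rw [hcoe, v_smul_sub_one_apply_eq_of_mul_eq_one _ hs hsv]; exact hγd i j
  have hA'' : ∃ i j, Valued.v ϖ ^ m ≤ Valued.v ((((Matrix.GeneralLinearGroup.scalar (Fin 2) s * γ₁ : GL (Fin 2) (w.1.adicCompletion L)) : Matrix (Fin 2) (Fin 2) (w.1.adicCompletion L)) -
      ((1 : GL (Fin 1) (w.1.adicCompletion L)) : Matrix (Fin 1) (Fin 1) (w.1.adicCompletion L)) 0 0 • (1 : Matrix (Fin 2) (Fin 2) (w.1.adicCompletion L))) i j) := by
    obtain ⟨i, j, hij⟩ := hA'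
    refine ⟨i, j, ?_⟩
    rw [Units.val_one, Matrix.one_apply_eq, one_smul, hcoe, v_smul_sub_one_apply_eq_of_mul_eq_one _ hs hsv]; exact hij
  have hγint : ∀ i j, Valued.v (((Matrix.GeneralLinearGroup.scalar (Fin 2) s * γ₁ : GL (Fin 2) (w.1.adicCompletion L)) : Matrix (Fin 2) (Fin 2) (w.1.adicCompletion L)) i j) ≤ 1 := by
    rw [hcoe]; exact forall_v_smul_apply_le_one hsv.le hγ₁int
  have hγU' := scalar_mul_mem_unitaryGroupOfForm hγU s hsnorm
  have hirr'' : ∀ x : (w.1.adicCompletion L), ¬ (((Matrix.GeneralLinearGroup.scalar (Fin 2) s * γ₁ : GL (Fin 2) (w.1.adicCompletion L)) : Matrix (Fin 2) (Fin 2) (w.1.adicCompletion L)).charpoly).IsRoot x := by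
    rw [hcoe]; exact forall_not_isRoot_charpoly_smul (Units.ne_zero s) hirr'
  have hu1 : Valued.v (((1 : GL (Fin 1) (w.1.adicCompletion L)) : Matrix (Fin 1) (Fin 1) (w.1.adicCompletion L)) 0 0) ≤ 1 := by
    rw [Units.val_one, Matrix.one_apply_eq, map_one]
  have hlam : Valued.v ((1 : (w.1.adicCompletion L)) - 1) ≤ Valued.v ϖ ^ m := by rw [sub_self, map_zero]; exact zero_le
  -- the centred literal `γ′`: characteristic polynomial, root token, integrality
  have hchar : (((γ' : GL (Fin 3) (w.1.adicCompletion L)) : Matrix (Fin 3) (Fin 3) (w.1.adicCompletion L))).charpoly =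
      (X - C (1 : (w.1.adicCompletion L))) * (((Matrix.GeneralLinearGroup.scalar (Fin 2) s * γ₁ : GL (Fin 2) (w.1.adicCompletion L)) : Matrix (Fin 2) (Fin 2) (w.1.adicCompletion L))).charpoly := by
    rw [hγ']; exact charpoly_coe_conj_endoGL_one P₁ _
  have hroot : (stdLattice (w.1.adicCompletion L) 3).map ((Matrix.toLin' (((γ' : GL (Fin 3) (w.1.adicCompletion L)) : Matrix (Fin 3) (Fin 3) (w.1.adicCompletion L)) - 1)).restrictScalars (Valued.integer (w.1.adicCompletion L))) ≤
      scaleLattice (ϖ ^ m) (stdLattice (w.1.adicCompletion L) 3) := by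
    rw [hγ']
    exact map_sub_one_stdLattice_le_scaleLattice_of_conj_endoGL_one (pow_ne_zero _ hϖ0) hPint hPinv (fun i j => by rw [map_pow]; exact hBm i j)
  have hm1 : 1 ≤ m := by omega
  have hlt1 : Valued.v ϖ ^ m < 1 := pow_lt_one₀ zero_le hϖlt (by omega)
  have hγ'0 : γ' ∈ unitaryInt (galAdicCompletionMap (L := L) (IsCMField.complexConj L) hw) ((StdForm.antidiagonal 3).over (w.1.adicCompletion L)) := by
    have h1 : IsIntMatrix (((γ' : GL (Fin 3) (w.1.adicCompletion L)) : Matrix (Fin 3) (Fin 3) (w.1.adicCompletion L))) := by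
      rw [hγ']; exact isIntMatrix_coe_conj_endoGL hPint hPinv hγint isIntMatrix_coe_one
    have h2' : IsIntMatrix ((((γ' : GL (Fin 3) (w.1.adicCompletion L)))⁻¹ : GL (Fin 3) (w.1.adicCompletion L)) : Matrix (Fin 3) (Fin 3) (w.1.adicCompletion L)) := by
      rw [hγ']
      exact isIntMatrix_coe_conj_endoGL_inv hPint hPinv (isIntMatrix_coe_inv_of_forall_v_sub_one_le_of_lt_one hlt1 hBm)
        (by rw [inv_one]; exact isIntMatrix_coe_one)
    have h := mem_unitaryInt_of_isIntMatrix γ'.2 h1 h2'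
    simpa only [Subtype.coe_eta] using h
  -- THE HEAD at `γ′`, zero row
  have key := strataCount_J₀_of_charpoly_block_raw_singleton_of_anisotropic_frame_of_entry hσσ hvσ hσϖ hϖ hres h2v hnorm hγ'0 1 _ hchar hlam hBm hroot
    mA hmA c η hc hηv hε (Fintype.card (Valued.ResidueField (w.1.adicCompletion L))) rfl hsq P₁ hform' hP0 hd hσd han₀ han₁ hση hηv
    (Matrix.GeneralLinearGroup.scalar (Fin 2) s * γ₁) 1 hγ' hγint hu1 hγU' hirr'' hA'' NE NP NM hNE hNP hNM 4
  simp only [Matrix.cons_val] at key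
  -- MOVE `γ′ ↦ Y = P₁·ι(γ₁, u_w)·P₁⁻¹`: the depth-`≤ 2` strata sets do not see the `2`-deep unit central rescaling (★ p849074 §5)
  have hTT : ((γ' : GL (Fin 3) (w.1.adicCompletion L)) : Matrix (Fin 3) (Fin 3) (w.1.adicCompletion L)) =
      (s : (w.1.adicCompletion L)) • ((P₁ * endoGL (γ₁, ((localNonsplitEquiv (IsCMField.complexConj L) (Matrix.of fun i j : Fin 1 => if i.val + j.val + 1 = 1 then (1 : L) else 0) (IsCMField.complexConj_ne_one L) w hw γH.2).val : GL (Fin 1) (w.1.adicCompletion L))) * P₁⁻¹ : GL (Fin 3) (w.1.adicCompletion L)) : Matrix (Fin 3) (Fin 3) (w.1.adicCompletion L)) := by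
    rw [hγ']; exact coe_conj_endoGL_centred_eq_smul P₁ γ₁ _ s hs'
  have hset := setOf_strata_eq_of_coe_eq_smul hvσ hϖ ((StdForm.antidiagonal 3).over (w.1.adicCompletion L)) hsv hs1
    (P₁ * endoGL (γ₁, ((localNonsplitEquiv (IsCMField.complexConj L) (Matrix.of fun i j : Fin 1 => if i.val + j.val + 1 = 1 then (1 : L) else 0) (IsCMField.complexConj_ne_one L) w hw γH.2).val : GL (Fin 1) (w.1.adicCompletion L))) * P₁⁻¹)
    (γ' : GL (Fin 3) (w.1.adicCompletion L)) hTT c (c * η) 4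
  simp only [Matrix.cons_val] at hset
  rw [placeForm_antidiagOne, ← hset, key]
  split_ifs <;> (simp only [Pi.add_apply, Pi.smul_apply, smul_eq_mul, Matrix.cons_val]; push_cast; rw [hq])

end Literature.NumberTheory.Rogawski1990.BlockLawAniso

end
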